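import Mathlib
import Summits.NavierStokesRegularity.NavierStokesRegularity.Theorems.QuarterLogPincerLimitSilenceNormalisation
import HarnessLib

/-!
# Line `limit_silence`: the failing family is EXACTLY the negation of Sc′ (kernel fact) — refuter lane ns-afl-r1

Supports crux stmt-NavierStokesRegularity-24077 (`QuarterLogPincer.TypeIQuantSubcubicExp`) via ns-idea-7's line
`Cruxes/TypeIQuantSubcubicExp/Lines/limit_silence.lean` (v1, sha16 e32cd2951105b65f), whose vocabulary is in the
tree BY NAME (`…Theorems.QuarterLogPincerLimitSilenceDefs`: `ThickBoxSilencingCost` = Sc′, `FailingFamily`,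
`Normalisation`; pub-ns-dss typer g38) together with the PROVED normalisation step L1a
`LimitSilence.stub_failingFamily : ¬ ThickBoxSilencingCost → FailingFamily`
(`…Theorems.QuarterLogPincerLimitSilenceNormalisation`).  NO Theses decl is asserted; nothing about the crux, about
Sc′ or about the open stubs L1b `LimitStep`, L2 `NoWitness` is proved or refuted (HONEST FRAME: 24077, W7 and
Navier–Stokes regularity are OPEN).

* `not_thickBoxSilencingCost_of_failingFamily : FailingFamily → ¬ ThickBoxSilencingCost` — the converse of L1a:
  member `n` of a normalised failing family, read at unit scale (`σ = 1`, `y = 0`, `t = 0`, `t₁ = s₁`) with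
  `Γ₂ + n ≥ K` and `1/(n+1) ≤ c`, violates Sc′'s conclusion (audit v8 §1 F1, now kernel-checked).
* `failingFamily_iff_not_thickBoxSilencingCost : FailingFamily ↔ ¬ ThickBoxSilencingCost` — so the
  compactness–rigidity route L1b ∘ L2 of the line loses NOTHING: refuting Sc′ and exhibiting a normalised failing
  family are the same task; `limitStep_of_thickBoxSilencingCost : ThickBoxSilencingCost → LimitStep` (L1b is
  implied by its own target, so it is refutable only through Sc′ itself).
-/

-- the summit and its single sub-problem share the name (CONVENTIONS §1), as in every Theorems file
set_option linter.dupNamespace false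

namespace Summit.NavierStokesRegularity.NavierStokesRegularity.Theorems.TypeIQuantSubcubicExp.Negative.LimitSilence

noncomputable section

open MeasureTheory Set Metric
open scoped Laplacian
open Literature.Analysis Literature.Analysis.FluidPDE
open Summit.NavierStokesRegularity.NavierStokesRegularity.Cruxes.TypeIQuantSubcubicExp.LimitSilence
  (ThickBoxSilencingCost FailingFamily LimitStep stub_failingFamily)

/-- **The converse of L1a**: a normalised failing family refutes Sc′ `ThickBoxSilencingCost`. -/
theorem not_thickBoxSilencingCost_of_failingFamily (h : FailingFamily) : ¬ ThickBoxSilencingCost := by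
  intro hS
  obtain ⟨B, δ, Γ₂, hB, hδ, hΓ₂, hfam⟩ := h
  obtain ⟨K, c, hK, hc, -, H⟩ := hS B δ Γ₂ hB hδ hΓ₂
  -- an index `n` with `K ≤ Γ₂ + n` and `1/(n+1) ≤ c`
  obtain ⟨n, hn⟩ := exists_nat_ge (max K (1 / c))
  have hnK : K ≤ Γ₂ + n := by
    have : K ≤ (n : ℝ) := (le_max_left _ _).trans hn
    linarith
  have hnc : 1 / ((n : ℝ) + 1) ≤ c := by
    have h1 : 1 / c ≤ (n : ℝ) := (le_max_right _ _).trans hn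
    have h2 : 1 ≤ c * n := by
      have := mul_le_mul_of_nonneg_left h1 hc.le
      rwa [mul_one_div_cancel hc.ne'] at this
    rw [div_le_iff₀ (by positivity)]
    nlinarith
  obtain ⟨ω, s₁, hs₁, hs₁1, hsm, hbox, hinit, hfinal⟩ := hfam n
  have hbox' : ∀ s ∈ Icc (0 : ℝ) s₁, ∀ x ∈ ball (0 : EuclideanSpace ℝ (Fin 3)) (2 * K * 1),
      ‖ω s x‖ ≤ B * (1 : ℝ) ^ (-(2 : ℝ)) ∧ ‖fderiv ℝ (ω s) x‖ ≤ B * (1 : ℝ) ^ (-(3 : ℝ)) ∧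
      ‖timeDerivWithin (Icc 0 s₁) ω s x - (Δ (ω s)) x‖ ≤
        B * (1 : ℝ) ^ (-(2 : ℝ)) * ‖ω s x‖ + B * (1 : ℝ) ^ (-(1 : ℝ)) * ‖fderiv ℝ (ω s) x‖ := by
    intro s hs x hx
    have hx' : x ∈ ball (0 : EuclideanSpace ℝ (Fin 3)) (2 * (Γ₂ + n)) :=
      ball_subset_ball (by nlinarith) hx
    simpa only [Real.one_rpow, mul_one] using hbox s hs x hx'
  have hinit' : ENNReal.ofReal (δ / 1) ≤
      ∫⁻ x in ball (0 : EuclideanSpace ℝ (Fin 3)) (Γ₂ * 1), ‖ω 0 x‖ₑ ^ 2 := by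
    simpa only [div_one, mul_one] using hinit
  have key := H ω 0 1 0 s₁ one_pos hs₁ (by simpa only [one_pow, zero_add] using hs₁1) hsm hbox' hinit'
  have hmono : ∫⁻ x in ball (0 : EuclideanSpace ℝ (Fin 3)) (K * 1), ‖ω s₁ x‖ₑ ^ 2 ≤
      ∫⁻ x in ball (0 : EuclideanSpace ℝ (Fin 3)) (Γ₂ + n), ‖ω s₁ x‖ₑ ^ 2 :=
    lintegral_mono_set (ball_subset_ball (by simpa only [mul_one] using hnK))
  have hlt : ENNReal.ofReal c < ENNReal.ofReal (1 / ((n : ℝ) + 1)) := by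
    have hk : ENNReal.ofReal c ≤ ∫⁻ x in ball (0 : EuclideanSpace ℝ (Fin 3)) (K * 1), ‖ω s₁ x‖ₑ ^ 2 := by
      simpa only [div_one] using key
    exact lt_of_le_of_lt (hk.trans hmono) hfinal
  rw [ENNReal.ofReal_lt_ofReal_iff (by positivity)] at hlt
  linarith

/-- **Sc′'s failure IS a normalised failing family** (L1a by name + its converse): the compactness–rigidity route
`LimitStep ∘ NoWitness` of line `limit_silence` loses nothing. -/
theorem failingFamily_iff_not_thickBoxSilencingCost : FailingFamily ↔ ¬ ThickBoxSilencingCost :=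
  ⟨not_thickBoxSilencingCost_of_failingFamily, stub_failingFamily⟩

/-- Consequently Sc′ implies the compactness stub L1b `LimitStep` outright (vacuously: under Sc′ there is no
failing family) — L1b is no stronger than the target it serves; all the strength of the route sits in the pair
(L1b, L2) jointly, cf. the kernel `LimitSilence.thickBoxSilencingCost_of`. -/
theorem limitStep_of_thickBoxSilencingCost (hS : ThickBoxSilencingCost) : LimitStep :=
  fun hfam => absurd hS (not_thickBoxSilencingCost_of_failingFamily hfam)

end

end Summit.NavierStokesRegularity.NavierStokesRegularity.Theorems.TypeIQuantSubcubicExp.Negative.LimitSilence
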